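import Literature.MathematicalPhysics.QuantumFieldTheory.Balaban1983to89.B4Eq221L2FactorRegion

/-!
# [B4] p. 577 «|∂^ηh_j| ≤ O(M⁻¹), |Δ^ηh_j| ≤ O(M⁻²)» ON A UNION OF LARGE BLOCKS: the sizes `HSizeR` of
# `B4Eq221L2FactorRegion` DISCHARGED for [Balaban1983RegularityDecay]'s own partition function `h_j`
# (`B4Eq220PartitionSizes.hZ`) on every fine region over a union of `K`-blocks — the boundary cubes «□_j is a sum of
# several (≤ 2^d) large blocks» —, hence the `‖·‖_{2,2}` factor bound of (2.21) «‖K_jG_k(□_j,Ã_j)h_j‖_{2,2} ≤ c₂O(1)M⁻¹» at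
# the boundary cubes with NO hypothesis on `h_j` left

statement-level skeleton of published theorems with citation tags; proofs where landed; nothing here is a claim about the Yang–Mills mass gap

CITATION HEADER.  T. Bałaban, *Regularity and decay of lattice Green's functions*, Commun. Math. Phys. **89** (1983)
571–597, doi:10.1007/bf01214744 [Balaban1983RegularityDecay] (cell paper B4; held text
`paper:balaban1983-cmp89-regularity-decay`, journal page = PDF page + 570; pp. 575–578).  Unit `lit-balaban-p35` gen 5,
HOME `run/shared/lean/pub/lit-balaban/`, SKELETON rows **B4.Def§2** (`h_j`), **B4.Eq2.10**, **B4.Eq2.18** at the boundary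
cubes.  Theorems only; imports `B4Eq221L2FactorRegion` (`HSizeR`, `kOpR`, `eq221_l2_region_Minv`) and, through it, r01's
`B4Eq220PartitionSizes` (`hZ` = the printed `h_j` on the fine lattice; `grad_hZ_le`, `secondDiff_hZ_le`,
`hprof_int_sub_eq`, `abs_hCube_sub_le`) whose box versions (`neumann_sum_hBox_eq`, `hsize_hBox`) this file extends from
boxes to unions of large blocks.

WHAT IS PRINTED.  p. 575: «Ω is a sum of the corresponding large blocks of the size M on η-lattice T_η. … For Mj lying on
the boundary the set □_j is a sum of several (≤ 2^d) large blocks.»; p. 576: «where we have used the fact that the normal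
derivative of h_j to the boundary of □_j is equal to 0»; p. 577: «|∂^ηh_j| ≤ O(M⁻¹), |Δ^ηh_j| ≤ O(M⁻²)».

WHAT THIS MODULE PROVES (all in full; mesh `n ≥ 1`, large-block size `K ≥ 1` (the print's `M`) with `nK ≥ 3`, the
region `□ = fineDom n Ωc` over a set `Ωc` of unit labels which is a union of `K`-blocks (`B4Lower18.IsBlockUnion K Ωc`),
`h_j(x) = hZ n K j x`).
* §1–§2 FLATNESS ON THE `nK`-GRID: `hZ_sub_e1_eq_of_dvd` / `hZ_add_e1_eq_of_dvd` — if `nK ∣ x_i` (resp. `nK ∣ x_i + 1`)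
  the neighbour `x − e_i` (resp. `x + e_i`) carries the same value of `h_j` (`h = 1` near the integers,
  `B4Eq220PartitionSizes.hprof_int_sub_eq`); `dvd_of_sub_e1_not_mem` / `dvd_of_add_e1_not_mem` — a site of `□` whose
  neighbour leaves `□` sits on the `nK`-grid (the faces of a union of `K`-blocks).
* §3 **`neumann_sum_hZ_region_eq`** — THE NEUMANN LAPLACIAN OF `h_j` ON `□` IS ITS FULL LAPLACIAN («the normal derivative
  of h_j to the boundary of □_j is equal to 0»); **`hsizeR_hZ`** — `HSizeR n Ωc h_j (s/K) (s/K²) (s/K)`,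
  `s = (d+1)(D1(h) + D2(h))`: the three printed sizes on every union of large blocks.
* §4 **`eq221_l2_region_hZ`** — «‖K_jG_k(□_j,Ã_j)h_j‖_{2,2} ≤ c₂O(1)M⁻¹» AT A BOUNDARY CUBE WITH NOTHING ASSUMED ON `h_j`:
  for every union `□` of large blocks, every vector field `A` regular (1.7) on `□` with «e ≤ e₀» (the hypotheses of
  `B4Lemma21Region.green_sq_le_region`), `a > 0`, `m² ≥ 0`:
  `‖K_{h_j}G_k(□,A)(h_jΦ)‖₂ ≤ (2(d+1)γ^{−1/2} + (1 + a)γ⁻¹)·s·K⁻¹·‖Φ‖₂`, `γ = min(2,a)/4 + m²`.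

HONEST SCOPE.  Counting-measure `ℓ²` (`lpM 2`); the region is any finite union of `K`-blocks of unit labels (the print's
`□_j` for boundary `j` is such, being `Ω ∩` a `2M`-cube with `Ω` a union of `M`-blocks); constants through `D1`, `D2` of
r01's concrete profile; nothing of (2.12)–(2.13), (2.18)–(2.19), (2.22) is summed here.  No `def`, no `Prop` fact, no
`sorry`; axioms standard.
-/

namespace Literature.MathematicalPhysics.QuantumFieldTheory.Balaban1983to89.B4Eq221HjRegion

open Finset Matrix
open Literature.MathematicalPhysics.QuantumFieldTheory.Balaban1983to89.B4GaugeCovariance (OrthFlow)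
open Literature.MathematicalPhysics.QuantumFieldTheory.Balaban1983to89.B4Commutators25to211 (mulH)
open Literature.MathematicalPhysics.QuantumFieldTheory.Balaban1983to89.B4Reflection242 (nbrs blk mem_nbrs)
open Literature.MathematicalPhysics.QuantumFieldTheory.Balaban1983to89.B4Green242Bridge (sum_nbrs)
open Literature.MathematicalPhysics.QuantumFieldTheory.Balaban1983to89.B4Lower18 (fineDom mem_fineDom IsBlockUnion)
open Literature.MathematicalPhysics.QuantumFieldTheory.Balaban1983to89.B4Lower18Regular (e1)
open Literature.MathematicalPhysics.QuantumFieldTheory.Balaban1983to89.B4Lemma21Region (regionOp)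
open Literature.MathematicalPhysics.QuantumFieldTheory.Balaban1983to89.B4Lemma22LpStair (lpM lpM_nonneg)
open Literature.MathematicalPhysics.QuantumFieldTheory.Balaban1983to89.B4PartitionUnity22 (hprof hCube D1 D2 D1_nonneg
  D2_nonneg contDiff_hprof hasCompactSupport_hprof)
open Literature.MathematicalPhysics.QuantumFieldTheory.Balaban1983to89.B4Eq220PartitionSizes (hZ hZ_mem_Icc grad_hZ_le
  secondDiff_hZ_le hprof_int_sub_eq abs_hCube_sub_le)
open Literature.MathematicalPhysics.QuantumFieldTheory.Balaban1983to89.B4Eq221L2FactorRegion (HSizeR kOpR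
  eq221_l2_region_Minv)

noncomputable section

variable {d : ℕ}

/-! ## §1. Integer plumbing: nested blocks, the `nK`-grid -/

/-- `⌊(t−1)/N⌋ ≠ ⌊t/N⌋` forces `N ∣ t` (`N > 0`). [folklore] -/
private theorem dvd_of_pred_ediv_ne {N t : ℤ} (hN : 0 < N) (h : (t - 1) / N ≠ t / N) : N ∣ t := by
  by_contra hnd
  apply h
  have hr0 : t % N ≠ 0 := fun h0 => hnd (Int.dvd_of_emod_eq_zero h0)
  have hr1 : 0 ≤ t % N := Int.emod_nonneg t hN.ne'
  have hr2 : t % N < N := Int.emod_lt_of_pos t hN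
  have ht : t % N + N * (t / N) = t := Int.emod_add_mul_ediv t N
  have key := (Int.ediv_emod_unique hN).2
    ⟨(by linarith [ht] : (t % N - 1) + N * (t / N) = t - 1), by omega, by omega⟩
  exact key.1

/-- `⌊(t+1)/N⌋ ≠ ⌊t/N⌋` forces `N ∣ t + 1` (`N > 0`). [folklore] -/
private theorem dvd_of_succ_ediv_ne {N t : ℤ} (hN : 0 < N) (h : (t + 1) / N ≠ t / N) : N ∣ t + 1 :=
  dvd_of_pred_ediv_ne hN (by rwa [add_sub_cancel_right, ne_comm])

/-- nested blocks: the `K`-block of the unit label of a fine site is its `nK`-block. [folklore] -/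
private theorem blk_blk (n K : ℕ) (x : Fin (d + 1) → ℤ) : blk K (blk n x) = blk (n * K) x := by
  funext μ
  simp only [blk]
  push_cast
  exact Int.ediv_ediv_of_nonneg (by positivity)

/-! ## §2. Flatness of `h_j` across the `nK`-grid -/

/-- `h_j` on the fine lattice as the product of the one-dimensional profiles. [cite: Balaban1983RegularityDecay, §2 p.575] -/
private theorem hZ_eq_prod (n K : ℕ) (j x : Fin (d + 1) → ℤ) :
    hZ n K j x = ∏ μ, hprof (((x μ : ℤ) : ℝ) / n / K - j μ) := rfl

/-- `K ≥ 1` from `nK ≥ 3` (private plumbing). [folklore] -/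
private theorem one_le_K_of {n K : ℕ} (hnK : 3 ≤ n * K) : 1 ≤ K := by
  rcases Nat.eq_zero_or_pos K with h0 | h0
  · subst h0; simp at hnK
  · exact h0

/-- **FLATNESS ACROSS A LOW FACE OF THE `nK`-GRID** («the normal derivative of h_j to the boundary of □_j is equal to
0», p. 576): if `nK ∣ x_i` then `h_j(x − e_i) = h_j(x)` (mesh `n`, `nK ≥ 3`).
[cite: Balaban1983RegularityDecay, (2.7) p.576] -/
theorem hZ_sub_e1_eq_of_dvd {n K : ℕ} (hn : 1 ≤ n) (hnK : 3 ≤ n * K) (j : Fin (d + 1) → ℤ)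
    {x : Fin (d + 1) → ℤ} {i : Fin (d + 1)} (hx : ((n * K : ℕ) : ℤ) ∣ x i) :
    hZ n K j (x - Pi.single i 1) = hZ n K j x := by
  have hnr : (0 : ℝ) < n := by exact_mod_cast hn
  have hKr : (0 : ℝ) < K := by exact_mod_cast one_le_K_of hnK
  have hnKr : (3 : ℝ) ≤ (n : ℝ) * K := by exact_mod_cast hnK
  obtain ⟨m, hm⟩ := hx
  rw [hZ_eq_prod, hZ_eq_prod]
  refine Finset.prod_congr rfl fun μ _ => ?_
  by_cases hμ : μ = i
  · subst hμ
    have k1 : (((x - Pi.single μ 1 : Fin (d + 1) → ℤ) μ : ℤ) : ℝ) / n / K - (j μ : ℝ)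
        = (((m - j μ : ℤ)) : ℝ) - 1 / ((n : ℝ) * K) := by
      rw [Pi.sub_apply, Pi.single_eq_same, hm]
      push_cast
      field_simp
      ring
    have k2 : ((x μ : ℤ) : ℝ) / n / K - (j μ : ℝ) = (((m - j μ : ℤ)) : ℝ) := by
      rw [hm]
      push_cast
      field_simp
    rw [k1, k2]
    refine hprof_int_sub_eq _ (by positivity) ?_
    rw [div_le_iff₀ (by positivity)]
    linarith
  · rw [Pi.sub_apply, Pi.single_eq_of_ne hμ, sub_zero]

/-- **FLATNESS ACROSS A HIGH FACE OF THE `nK`-GRID**: if `nK ∣ x_i + 1` then `h_j(x + e_i) = h_j(x)`.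
[cite: Balaban1983RegularityDecay, (2.7) p.576] -/
theorem hZ_add_e1_eq_of_dvd {n K : ℕ} (hn : 1 ≤ n) (hnK : 3 ≤ n * K) (j : Fin (d + 1) → ℤ)
    {x : Fin (d + 1) → ℤ} {i : Fin (d + 1)} (hx : ((n * K : ℕ) : ℤ) ∣ x i + 1) :
    hZ n K j (x + Pi.single i 1) = hZ n K j x := by
  have hnr : (0 : ℝ) < n := by exact_mod_cast hn
  have hKr : (0 : ℝ) < K := by exact_mod_cast one_le_K_of hnK
  have hnKr : (3 : ℝ) ≤ (n : ℝ) * K := by exact_mod_cast hnK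
  obtain ⟨m, hm⟩ := hx
  have hm' : x i = ((n * K : ℕ) : ℤ) * m - 1 := by linarith
  rw [hZ_eq_prod, hZ_eq_prod]
  refine Finset.prod_congr rfl fun μ _ => ?_
  by_cases hμ : μ = i
  · subst hμ
    have k1 : (((x + Pi.single μ 1 : Fin (d + 1) → ℤ) μ : ℤ) : ℝ) / n / K - (j μ : ℝ)
        = (((m - j μ : ℤ)) : ℝ) := by
      rw [Pi.add_apply, Pi.single_eq_same, hm]
      push_cast
      field_simp
    have k2 : ((x μ : ℤ) : ℝ) / n / K - (j μ : ℝ) = (((m - j μ : ℤ)) : ℝ) - 1 / ((n : ℝ) * K) := by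
      rw [hm']
      push_cast
      field_simp
      ring
    rw [k1, k2]
    refine (hprof_int_sub_eq _ (by positivity) ?_).symm
    rw [div_le_iff₀ (by positivity)]
    linarith
  · rw [Pi.add_apply, Pi.single_eq_of_ne hμ, add_zero]

/-- **THE FACES OF A UNION OF LARGE BLOCKS LIE ON THE `nK`-GRID, low side**: if `x ∈ □` and `x − e_i ∉ □` for the fine
region `□` over a union `Ωc` of `K`-blocks, then `nK ∣ x_i`. [cite: Balaban1983RegularityDecay, §2 p.575 «□_j is a sum of several (≤ 2^d) large blocks», dictionary] -/
theorem dvd_of_sub_e1_not_mem {n K : ℕ} (hn : 1 ≤ n) (hK : 1 ≤ K) {Ωc : Finset (Fin (d + 1) → ℤ)}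
    (hΩ : IsBlockUnion K Ωc) {x : Fin (d + 1) → ℤ} (hx : x ∈ fineDom n Ωc) {i : Fin (d + 1)}
    (hout : x - Pi.single i 1 ∉ fineDom n Ωc) : ((n * K : ℕ) : ℤ) ∣ x i := by
  rw [mem_fineDom hn] at hx hout
  have hne : blk K (blk n (x - Pi.single i 1)) ≠ blk K (blk n x) := fun heq => hout (hΩ hx heq)
  rw [blk_blk, blk_blk] at hne
  have hN : (0 : ℤ) < ((n * K : ℕ) : ℤ) := by exact_mod_cast Nat.mul_pos hn hK
  refine dvd_of_pred_ediv_ne hN fun heq => hne ?_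
  funext μ
  simp only [blk]
  by_cases hμ : μ = i
  · subst hμ
    rw [Pi.sub_apply, Pi.single_eq_same]
    exact heq
  · rw [Pi.sub_apply, Pi.single_eq_of_ne hμ, sub_zero]

/-- **THE FACES LIE ON THE `nK`-GRID, high side**: if `x ∈ □` and `x + e_i ∉ □` then `nK ∣ x_i + 1`.
[cite: Balaban1983RegularityDecay, §2 p.575, dictionary] -/
theorem dvd_of_add_e1_not_mem {n K : ℕ} (hn : 1 ≤ n) (hK : 1 ≤ K) {Ωc : Finset (Fin (d + 1) → ℤ)}
    (hΩ : IsBlockUnion K Ωc) {x : Fin (d + 1) → ℤ} (hx : x ∈ fineDom n Ωc) {i : Fin (d + 1)}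
    (hout : x + Pi.single i 1 ∉ fineDom n Ωc) : ((n * K : ℕ) : ℤ) ∣ x i + 1 := by
  rw [mem_fineDom hn] at hx hout
  have hne : blk K (blk n (x + Pi.single i 1)) ≠ blk K (blk n x) := fun heq => hout (hΩ hx heq)
  rw [blk_blk, blk_blk] at hne
  have hN : (0 : ℤ) < ((n * K : ℕ) : ℤ) := by exact_mod_cast Nat.mul_pos hn hK
  refine dvd_of_succ_ediv_ne hN fun heq => hne ?_
  funext μ
  simp only [blk]
  by_cases hμ : μ = i
  · subst hμ
    rw [Pi.add_apply, Pi.single_eq_same]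
    exact heq
  · rw [Pi.add_apply, Pi.single_eq_of_ne hμ, add_zero]

/-! ## §3. The Neumann Laplacian of `h_j` on a union of large blocks; the three sizes -/

/-- the sum over the nearest neighbours, real-valued: `Σ_{z ∈ nbrs x} φ z = Σ_μ φ(x + e_μ) + Σ_μ φ(x − e_μ)`. [folklore] -/
private theorem sum_nbrs_real (φ : (Fin (d + 1) → ℤ) → ℝ) (x : Fin (d + 1) → ℤ) :
    ∑ z ∈ nbrs x, φ z = ∑ μ, φ (x + Pi.single μ 1) + ∑ μ, φ (x - Pi.single μ 1) := by
  have h := sum_nbrs (fun z => (φ z : ℂ)) x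
  exact_mod_cast h

/-- **THE NEUMANN LAPLACIAN OF `h_j` IS ITS FULL LAPLACIAN ON A UNION OF LARGE BLOCKS**:
`Σ_{y ∼ x, y ∈ □}(h_j(y) − h_j(x)) = Σ_μ (h_j(x + e_μ) − 2h_j(x) + h_j(x − e_μ))` for the fine region `□` over a union of
`K`-blocks (`nK ≥ 3`) — the missing neighbours across the faces contribute nothing by flatness.
[cite: Balaban1983RegularityDecay, (2.7) p.576 «the normal derivative of h_j to the boundary of □_j is equal to 0»] -/
theorem neumann_sum_hZ_region_eq {n K : ℕ} (hn : 1 ≤ n) (hnK : 3 ≤ n * K) {Ωc : Finset (Fin (d + 1) → ℤ)}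
    (hΩ : IsBlockUnion K Ωc) (j : Fin (d + 1) → ℤ) (x : ↥(fineDom n Ωc)) :
    ∑ y ∈ univ.filter (fun y : ↥(fineDom n Ωc) => y.1 ∈ nbrs x.1), (hZ n K j y.1 - hZ n K j x.1)
      = ∑ μ, (hZ n K j (x.1 + Pi.single μ 1) - 2 * hZ n K j x.1 + hZ n K j (x.1 - Pi.single μ 1)) := by
  classical
  have hK := one_le_K_of hnK
  -- Step 1: as a sum over the lattice neighbours lying in the region
  have h1 : ∑ y ∈ univ.filter (fun y : ↥(fineDom n Ωc) => y.1 ∈ nbrs x.1), (hZ n K j y.1 - hZ n K j x.1)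
      = ∑ z ∈ (nbrs x.1).filter (fun z => z ∈ fineDom n Ωc), (hZ n K j z - hZ n K j x.1) := by
    have hB : ∑ y : ↥(fineDom n Ωc), (if y.1 ∈ nbrs x.1 then hZ n K j y.1 - hZ n K j x.1 else 0)
        = ∑ z ∈ fineDom n Ωc, (if z ∈ nbrs x.1 then hZ n K j z - hZ n K j x.1 else 0) :=
      (Finset.sum_subtype (fineDom n Ωc) (fun _ => Iff.rfl)
        (fun z => if z ∈ nbrs x.1 then hZ n K j z - hZ n K j x.1 else 0)).symm
    have hD : (fineDom n Ωc).filter (fun z => z ∈ nbrs x.1) = (nbrs x.1).filter (fun z => z ∈ fineDom n Ωc) := by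
      ext z
      simp only [Finset.mem_filter]
      exact and_comm
    rw [Finset.sum_filter, hB, ← Finset.sum_filter, hD]
  -- Step 2: the neighbours outside the region contribute zero (flatness across the faces)
  have h2 : ∑ z ∈ (nbrs x.1).filter (fun z => z ∈ fineDom n Ωc), (hZ n K j z - hZ n K j x.1)
      = ∑ z ∈ nbrs x.1, (hZ n K j z - hZ n K j x.1) := by
    apply Finset.sum_subset (Finset.filter_subset _ _)
    intro z hz hzN
    rw [Finset.mem_filter, not_and] at hzN
    have hout : z ∉ fineDom n Ωc := hzN hz
    obtain ⟨i, hzi | hzi⟩ := mem_nbrs.mp hz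
    · rw [hzi] at hout ⊢
      rw [hZ_add_e1_eq_of_dvd hn hnK j (dvd_of_add_e1_not_mem hn hK hΩ x.2 hout), sub_self]
    · rw [hzi] at hout ⊢
      rw [hZ_sub_e1_eq_of_dvd hn hnK j (dvd_of_sub_e1_not_mem hn hK hΩ x.2 hout), sub_self]
  -- Step 3: split the full neighbour sum into the `2(d+1)` directions
  rw [h1, h2, sum_nbrs_real, ← Finset.sum_add_distrib]
  refine Finset.sum_congr rfl fun μ _ => ?_
  ring

/-- two fine sites of one unit block differ by at most one unit length in every coordinate. [folklore] -/
private theorem abs_sub_div_le_one_of_blk_eq {n : ℕ} (hn : 1 ≤ n) {x y : Fin (d + 1) → ℤ} (h : blk n y = blk n x)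
    (μ : Fin (d + 1)) : |((y μ : ℤ) : ℝ) / n - ((x μ : ℤ) : ℝ) / n| ≤ 1 := by
  have hq : y μ / (n : ℤ) = x μ / (n : ℤ) := congrFun h μ
  have hn0 : (0 : ℤ) < n := by exact_mod_cast hn
  have hy := Int.emod_add_mul_ediv (y μ) (n : ℤ)
  have hx := Int.emod_add_mul_ediv (x μ) (n : ℤ)
  have hy1 := Int.emod_nonneg (y μ) hn0.ne'
  have hy2 := Int.emod_lt_of_pos (y μ) hn0
  have hx1 := Int.emod_nonneg (x μ) hn0.ne'
  have hx2 := Int.emod_lt_of_pos (x μ) hn0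
  have hdiff : |y μ - x μ| ≤ n := by
    rw [abs_le]
    constructor <;> nlinarith [hq]
  have hnR : (0 : ℝ) < n := by exact_mod_cast hn0
  rw [← sub_div, abs_div, abs_of_pos hnR, div_le_one hnR]
  exact_mod_cast hdiff

/-- **THE THREE SIZES OF `h_j` ON A UNION OF LARGE BLOCKS** — `HSizeR` of `B4Eq221L2FactorRegion` DISCHARGED: for
`n, K ≥ 1`, `nK ≥ 3` and `Ωc` a union of `K`-blocks, `HSizeR n Ωc h_j (s/K) (s/K²) (s/K)` with
`s = (d+1)(D1(h) + D2(h))` — «|∂^ηh_j| ≤ O(M⁻¹)» (`grad_hZ_le`), «|Δ^ηh_j| ≤ O(M⁻²)» for the Neumann Laplacian of the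
region (`neumann_sum_hZ_region_eq` + `secondDiff_hZ_le`), and the block oscillation (`abs_hCube_sub_le`).
[cite: Balaban1983RegularityDecay, §2 p.577 «|∂^ηh_j| ≤ O(M⁻¹), |Δ^ηh_j| ≤ O(M⁻²)»] -/
theorem hsizeR_hZ {n K : ℕ} (hn : 1 ≤ n) (hnK : 3 ≤ n * K) {Ωc : Finset (Fin (d + 1) → ℤ)}
    (hΩ : IsBlockUnion K Ωc) (j : Fin (d + 1) → ℤ) :
    HSizeR n Ωc (fun x => hZ n K j x.1) (((d : ℝ) + 1) * (D1 hprof + D2 hprof) / K)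
      (((d : ℝ) + 1) * (D1 hprof + D2 hprof) / (K : ℝ) ^ 2) (((d : ℝ) + 1) * (D1 hprof + D2 hprof) / K) := by
  have hK := one_le_K_of hnK
  have hKr : (0 : ℝ) < K := by exact_mod_cast hK
  have hnr : (0 : ℝ) < n := by exact_mod_cast hn
  have hD1 := D1_nonneg contDiff_hprof hasCompactSupport_hprof
  have hD2 := D2_nonneg contDiff_hprof hasCompactSupport_hprof
  have hd : (1 : ℝ) ≤ (d : ℝ) + 1 := by
    have : (0 : ℝ) ≤ d := Nat.cast_nonneg d
    linarith
  refine ⟨by positivity, by positivity, by positivity, ?_, ?_, ?_, ?_⟩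
  · intro x
    rw [abs_of_nonneg (hZ_mem_Icc n K j x.1).1]
    exact (hZ_mem_Icc n K j x.1).2
  · intro x y hy
    obtain ⟨i, hyi | hyi⟩ := mem_nbrs.mp hy
    · calc (n : ℝ) * |hZ n K j y.1 - hZ n K j x.1| ≤ D1 hprof / K := by
            rw [hyi]; exact (grad_hZ_le hn hK j x.1 i).1
        _ ≤ ((d : ℝ) + 1) * (D1 hprof + D2 hprof) / K := by
            rw [div_le_div_iff_of_pos_right hKr]; nlinarith
    · calc (n : ℝ) * |hZ n K j y.1 - hZ n K j x.1| ≤ D1 hprof / K := by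
            rw [hyi]; exact (grad_hZ_le hn hK j x.1 i).2
        _ ≤ ((d : ℝ) + 1) * (D1 hprof + D2 hprof) / K := by
            rw [div_le_div_iff_of_pos_right hKr]; nlinarith
  · intro x
    rw [neumann_sum_hZ_region_eq hn hnK hΩ j x, abs_mul, abs_of_pos (by positivity)]
    calc (n : ℝ) ^ 2 * |∑ μ, (hZ n K j (x.1 + Pi.single μ 1) - 2 * hZ n K j x.1 + hZ n K j (x.1 - Pi.single μ 1))|
        ≤ (n : ℝ) ^ 2 * ∑ μ : Fin (d + 1), D2 hprof * (1 / (n : ℝ)) ^ 2 / (K : ℝ) ^ 2 := by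
          refine mul_le_mul_of_nonneg_left ((Finset.abs_sum_le_sum_abs _ _).trans
            (Finset.sum_le_sum fun μ _ => secondDiff_hZ_le hn j x.1 μ)) (by positivity)
      _ = ((d : ℝ) + 1) * D2 hprof / (K : ℝ) ^ 2 := by
          rw [Finset.sum_const, Finset.card_univ, Fintype.card_fin, nsmul_eq_mul]
          push_cast
          field_simp
      _ ≤ ((d : ℝ) + 1) * (D1 hprof + D2 hprof) / (K : ℝ) ^ 2 := by
          rw [div_le_div_iff_of_pos_right (by positivity)]; nlinarith
  · intro x y hy
    calc |hZ n K j x.1 - hZ n K j y.1| ≤ D1 hprof / K * ∑ μ, |((x.1 μ : ℤ) : ℝ) / n - ((y.1 μ : ℤ) : ℝ) / n| :=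
          abs_hCube_sub_le hKr j _ _
      _ ≤ D1 hprof / K * ∑ _μ : Fin (d + 1), (1 : ℝ) := by
          refine mul_le_mul_of_nonneg_left (Finset.sum_le_sum fun μ _ => ?_) (div_nonneg hD1 hKr.le)
          rw [abs_sub_comm]
          exact abs_sub_div_le_one_of_blk_eq hn hy μ
      _ = ((d : ℝ) + 1) * D1 hprof / K := by
          rw [Finset.sum_const, Finset.card_univ, Fintype.card_fin, nsmul_eq_mul, mul_one]
          push_cast
          ring
      _ ≤ ((d : ℝ) + 1) * (D1 hprof + D2 hprof) / K := by
          rw [div_le_div_iff_of_pos_right hKr]; nlinarith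

/-! ## §4. «‖K_jG_k(□_j,Ã_j)h_j‖_{2,2} ≤ c₂O(1)M⁻¹» at a boundary cube, nothing assumed on `h_j` -/

section L2

variable {ι : Type} [Fintype ι] [DecidableEq ι]

variable (F : OrthFlow ι) {ℓ : ℝ} (hℓ : 0 ≤ ℓ)
  (hLip : ∀ t (v : ι → ℝ), ((F.U t - 1) *ᵥ v) ⬝ᵥ ((F.U t - 1) *ᵥ v) ≤ (ℓ * t) ^ 2 * (v ⬝ᵥ v))
  {e : ℝ} (he : 0 < e) {n : ℕ} (hn : 1 ≤ n) {a : ℝ} (ha : 0 < a) {m2 : ℝ} (hm : 0 ≤ m2)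
  (Ωc : Finset (Fin (d + 1) → ℤ)) {Ac : (Fin (d + 1) → ℤ) → Fin (d + 1) → ℝ} {c β : ℝ} (hc : 0 ≤ c)
  (h17 : ∀ x ∈ fineDom n Ωc, ∀ μ ν : Fin (d + 1), |Ac (x + e1 μ) ν - Ac x ν| ≤ c * e ^ (β - 1) / n)
  (hsmall : ℓ ^ 2 * ((d + 1) * c * e ^ β) ^ 2 * (d + 1) * (1 + a * (d + 1)) ≤ min 2 a / 4)

include hℓ hLip he ha hm hc h17 hsmall

/-- **THE `‖·‖_{2,2}` FACTOR OF (2.21) AT A BOUNDARY CUBE FOR [B4]'s OWN `h_j`, NOTHING ASSUMED ON `h_j`**: for the fine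
region `□` over ANY finite union `Ωc` of `K`-blocks (`K` the print's `M`, mesh `n`, `nK ≥ 3`), ANY vector field `A` regular (1.7) on `□`
with «e ≤ e₀» (the hypotheses of `B4Lemma21Region.green_sq_le_region`), `a > 0`, `m² ≥ 0`, every label `j` and every
`Φ`: `‖K_{h_j}G_k(□,A)(h_jΦ)‖₂ ≤ (2(d+1)γ^{−1/2} + (1 + a)γ⁻¹)·(d+1)(D1(h) + D2(h))·K⁻¹·‖Φ‖₂`, `γ = min(2,a)/4 + m²` —
«c₂O(1)M⁻¹» with `c₂` from Lemma 2.1 and `O(1)` explicit.  `B4Eq221L2FactorRegion.eq221_l2_region_Minv` + `hsizeR_hZ`.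
[cite: Balaban1983RegularityDecay, (2.21) p. 578 «‖K_{ω_i}G_k(□_{ω_i},Ã_{ω_i})h_{ω_i}‖_{2,2}», «c₂O(1)M⁻¹», with Lemma 2.1 (2.15) p. 577, (2.10) p. 576, §2 p. 577] -/
theorem eq221_l2_region_hZ {K : ℕ} (hnK : 3 ≤ n * K) (hΩ : IsBlockUnion K Ωc) (j : Fin (d + 1) → ℤ)
    (Φ : ↥(fineDom n Ωc) × ι → ℝ) :
    lpM 2 (kOpR F e hn a m2 Ωc Ac (fun x => hZ n K j x.1)
        *ᵥ ((regionOp F e hn a m2 Ωc Ac)⁻¹ *ᵥ (mulH (ι := ι) (fun x : ↥(fineDom n Ωc) => hZ n K j x.1) *ᵥ Φ)))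
      ≤ (2 * ((d : ℝ) + 1) * (Real.sqrt (min 2 a / 4 + m2))⁻¹ + (1 + a) * (min 2 a / 4 + m2)⁻¹)
        * (((d : ℝ) + 1) * (D1 hprof + D2 hprof)) / K * lpM 2 Φ := by
  have hK1 : 1 ≤ K := one_le_K_of hnK
  have hs : 0 ≤ ((d : ℝ) + 1) * (D1 hprof + D2 hprof) := by
    have := D1_nonneg contDiff_hprof hasCompactSupport_hprof
    have := D2_nonneg contDiff_hprof hasCompactSupport_hprof
    positivity
  have hKr : (1 : ℝ) ≤ K := by exact_mod_cast hK1
  exact eq221_l2_region_Minv F hℓ hLip he hn ha hm Ωc hc h17 hsmall hKr hs (hsizeR_hZ hn hnK hΩ j) Φ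

end L2

end

end Literature.MathematicalPhysics.QuantumFieldTheory.Balaban1983to89.B4Eq221HjRegion
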